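import Summits.Parity.GeneralizedHardyLittlewood.Theorems.RootExistenceConservationPatterns

/-!
# Root existence conservation (3/4): the conservation schema at the root and the twin dictionary

Part of the CYCLE-2 ROOT CERTIFICATE «RootExistenceConservation» of the decomp-parity cell (lens-6 g9 NODE
HOME/STATUS.md l.468, REVISED v2 l.481; critic CLEARED l.472 = CRITIC-LEDGER row 87 against the spec (i)–(vi); writer
LANDING LIST L5 l.476).  The lens hand `HOME/decomp-parity-lens-6/g9/hand/RootExistenceConservation.lean`
(sha16 471e26ada0e68a15, 1250 lines, 99 theorems, 0 def, rc 0 · 0 sorry · standard axioms) is landed VERBATIM in four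
files for the 400-line Theorems lint by the cell's prover-class seat census-1 g10:
`RootExistenceConservationShapes` (§0–§2) → `RootExistenceConservationPatterns` (§3–§5a) →
`RootExistenceConservationTwins` (§5.1–§5.4) → `RootExistenceConservation` (§5.5–§5.9, barrier tie + door instances).
Vocabulary: `Theorems/RootExistenceConservationDefs.lean`.

§5.1 (i) the n-ary conservation schema `root_conservation`; §5.2 the twin face of the record and of the conjunct
BY NAME (Green–Tao Example 1, `twinPrimeSystem`); §5.3 (ii) `¬TwinPoor` ⟺ Chebyshev-i.o. twin lower bound ⟹ infinitely
many twin primes (Mathlib `Chebyshev.abs_psi_sub_theta_le_sqrt_mul_log`); §5.4 (i)+(iv) at the root: every residual family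
beneath `Parity` refutes `TwinPoor`.
-/

open scoped BigOperators
open Finset

namespace Summit.Parity.GeneralizedHardyLittlewood.ExistenceConservation

/-! ## §3 The twin face of route-Parity-ClusterGapCarving, BY NAME -/

open scoped ArithmeticFunction.vonMangoldt
open Literature.NumberTheory.Sieve

open ScaleTauberianCarving (err dil FixedAt ScaleRigidityAt convex_dil dil_subset_realBox)

variable {d t : ℕ}


/-! ## §5 THE ROOT CERTIFICATE (cycle 2): conservation at `_root_.Parity` in the world `W := TwinPoor` -/

section Root

open Literature.NumberTheory.Sieve
open Literature.Barriers.Parity (twinSet twinParityWeight IsSieveTheoreticDeduction PrimePairParity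
  PrimePairParity_holds)

/-! ### §5.1 (i) The n-ary conservation schema -/

/-- **n-ary conservation.** In a split `S ⟸ ⋀ᵢ Pᵢ` of a statement refuting `W`, if every piece of the
sub-family `V` is `W`-vacuous, the conjunction of the remaining pieces refutes `W`. -/
theorem complement_refutes_family {ι : Sort*} {W S : Prop} (P V : ι → Prop) (hs : (∀ i, P i) → S)
    (hS : S → ¬W) (hV : ∀ i, V i → W → P i) : (∀ i, ¬ V i → P i) → ¬W :=
  fun hR w => hS (hs fun i => (Classical.em (V i)).elim (fun hv => hV i hv w) fun hv => hR i hv) w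

/-- If EVERY piece were `W`-vacuous, `¬W` would follow outright. -/
theorem all_vacuous_refutes {ι : Sort*} {W S : Prop} (P : ι → Prop) (hs : (∀ i, P i) → S) (hS : S → ¬W) :
    (∀ i, W → P i) → ¬W :=
  fun hV w => hS (hs fun i => hV i w) w

/-- A piece CONDITIONED on a `W`-refuting piece is `W`-vacuous (e.g. `UniformLowerGivenFixed := Q → FixedLower → …`). -/
theorem conditioned_on_refuting_vacuous {W F T : Prop} (hF : F → ¬W) : W → (F → T) :=
  fun w f => absurd w (hF f)

/-- … also behind a further antecedent. -/
theorem conditioned_on_refuting_vacuous₂ {W Q F T : Prop} (hF : F → ¬W) : W → (Q → F → T) :=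
  fun w _ f => absurd w (hF f)

/-! ### §5.2 The twin face of the record and of the conjunct, BY NAME (Green–Tao Example 1, `twinPrimeSystem`) -/

/-- The twin main-term coefficient `𝔖 = ∏_p β_p(twinPrimeSystem) ≥ 1` (tree: `one_le_singularProduct_twinPrimeSystem`). -/
theorem twin_singularProduct_pos : 0 < singularProduct twinPrimeSystem :=
  lt_of_lt_of_le one_pos one_le_singularProduct_twinPrimeSystem

/-- The record's `FixedLower` (stmt-Parity-26863), read at the twin system on the box `[-N, N]`, is the Λ-lower
shape of `X 2` with main term `𝔖·N`. [cite: GreenTao2010, Conj. 1.2 and Example 1] -/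
theorem lower_twin_of_fixedLower (hFL : Theses.SiegelSpectrumSplit.FixedLower) :
    Lower (X 2) (singularProduct twinPrimeSystem) := by
  intro ε hε
  obtain ⟨N₀, hN₀⟩ := hFL 1 2 le_rfl (by norm_num) twinPrimeSystem isNondegenerateSystem_twinPrimeSystem.1 ε hε
  refine ⟨N₀, fun N hN => ?_⟩
  have key := hN₀ N hN (realBox 1 N) (convex_Icc _ _) subset_rfl
  rw [vonMangoldtSum_twinPrimeSystem, archFactor_twinPrimeSystem, pow_one] at key
  have hX : X 2 N = ∑ n ∈ Finset.Icc 1 N, Λ n * Λ (n + 2) := rfl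
  rw [hX]
  linarith

/-- The conjunct `GeneralizedHardyLittlewood`, read at the twin system (`L = 3`, `N ≥ 2`), is the EXACT shape of
`X 2` with main term `𝔖·N`. [cite: GreenTao2010, Conj. 1.2 and Example 1] -/
theorem exact_twin_of_ghl (hG : _root_.GeneralizedHardyLittlewood) :
    Exact (X 2) (singularProduct twinPrimeSystem) := by
  intro ε hε
  obtain ⟨N₀, hN₀⟩ := hG 1 2 3 le_rfl (by norm_num) ε hε
  refine ⟨max N₀ 2, fun N hN => ?_⟩
  have hNN₀ : N₀ ≤ N := le_of_max_le_left hN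
  have h2N : 2 ≤ N := le_of_max_le_right hN
  have key := hN₀ N hNN₀ twinPrimeSystem isNondegenerateSystem_twinPrimeSystem.1
    (affLinSize_twinPrimeSystem_le h2N) (realBox 1 N) (convex_Icc _ _) subset_rfl
  rw [vonMangoldtSum_twinPrimeSystem, archFactor_twinPrimeSystem, pow_one] at key
  have hX : X 2 N = ∑ n ∈ Finset.Icc 1 N, Λ n * Λ (n + 2) := rfl
  rw [hX, mul_comm]
  exact key

/-- **The record leaf refutes twin poverty**: `FixedLower → ¬TwinPoor` (hypothesis-free). -/
theorem fixedLower_refutes_twinPoor (hFL : Theses.SiegelSpectrumSplit.FixedLower) : ¬ TwinPoor :=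
  not_poor_of_lower twin_singularProduct_pos (lower_twin_of_fixedLower hFL)

/-- **The conjunct refutes twin poverty**: `GeneralizedHardyLittlewood → ¬TwinPoor`. -/
theorem ghl_refutes_twinPoor (hG : _root_.GeneralizedHardyLittlewood) : ¬ TwinPoor :=
  not_poor_of_exact (ne_of_gt twin_singularProduct_pos) (exact_twin_of_ghl hG)

/-- **The root refutes twin poverty**: `Parity → ¬TwinPoor`. -/
theorem parity_refutes_twinPoor (hP : _root_.Parity) : ¬ TwinPoor :=
  ghl_refutes_twinPoor hP.2

/-- The record's `LowerGivenBoundedSiegel` (stmt-Parity-25150, `Q →` uniform lower half) refutes twin poverty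
modulo the typed Matomäki–Merikoski fact (which makes `Q` vacuous, §S1). -/
theorem lowerGivenQ_refutes_twinPoor (hMM : Literature.Barriers.Parity.MatomakiMerikoski2023_fixedShift)
    (hLQ : Theses.SiegelSpectrumSplit.LowerGivenBoundedSiegel) : ¬ TwinPoor := by
  intro hW
  have hQ := boundedSiegel_of_twinPoor hMM hW
  have hlow : Lower (X 2) (singularProduct twinPrimeSystem) := by
    intro ε hε
    obtain ⟨N₀, hN₀⟩ := hLQ hQ 1 2 3 le_rfl (by norm_num) ε hε
    refine ⟨max N₀ 2, fun N hN => ?_⟩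
    have hNN₀ : N₀ ≤ N := le_of_max_le_left hN
    have h2N : 2 ≤ N := le_of_max_le_right hN
    have key := hN₀ N hNN₀ twinPrimeSystem isNondegenerateSystem_twinPrimeSystem.1
      (affLinSize_twinPrimeSystem_le h2N) (realBox 1 N) (convex_Icc _ _) subset_rfl
    rw [vonMangoldtSum_twinPrimeSystem, archFactor_twinPrimeSystem, pow_one] at key
    have hX : X 2 N = ∑ n ∈ Finset.Icc 1 N, Λ n * Λ (n + 2) := rfl
    rw [hX]
    linarith
  exact not_poor_of_lower twin_singularProduct_pos hlow hW

/-- (iv, record) `UniformLowerGivenFixed` (stmt-Parity-26864) is `W`-VACUOUS, hypothesis-free: it is conditioned on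
the refuting leaf `FixedLower`. -/
theorem uniformLowerGivenFixed_of_twinPoor (hW : TwinPoor) : Theses.SiegelSpectrumSplit.UniformLowerGivenFixed :=
  fun _ hFL => absurd hW (fixedLower_refutes_twinPoor hFL)

/-- (iv, record) the record's residual list `{FixedLower, UniformLowerGivenFixed}` beneath `LQ` has W-refuting
complement exactly `{FixedLower}`: `UniformLowerGivenFixed` holds in `W`, and `FixedLower` alone refutes `W`. -/
theorem record_residual_locus :
    (TwinPoor → Theses.SiegelSpectrumSplit.UniformLowerGivenFixed) ∧
      (Theses.SiegelSpectrumSplit.FixedLower → ¬ TwinPoor) :=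
  ⟨uniformLowerGivenFixed_of_twinPoor, fixedLower_refutes_twinPoor⟩

/-- (iv, record) twin poverty at the PATTERN level: `TwinPoor` is `PoorAt twinPrimeSystem` read on the full box,
and the record's `FixedUpper` at the twin system then HOLDS on the box (upper envelope, no existence content). -/
theorem upper_twin_of_twinPoor (hW : TwinPoor) : Upper (X 2) (singularProduct twinPrimeSystem) :=
  upper_of_poor twin_singularProduct_pos.le hW

/-! ### §5.3 (ii) `¬TwinPoor` ⟺ Chebyshev-i.o. twin lower bound ⟹ infinitely many twin primes -/

/-- `¬TwinPoor ↔` the Λ-weighted twin Chebyshev lower bound infinitely often (currency of stmt-Parity-18377). -/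
theorem not_twinPoor_iff_chebyshevIO : ¬ TwinPoor ↔ ChebyshevIO (X 2) :=
  not_poor_iff_chebyshevIO (X_nonneg 2)

/-- The eventual Λ-Chebyshev twin lower bound (antecedent of `ClusterGapCarving.TwinResidualRel`) refutes `TwinPoor`. -/
theorem not_twinPoor_of_chebyshevEv (h : ChebyshevEv (X 2)) : ¬ TwinPoor :=
  not_poor_of_chebyshevEv h

/-- Non-prime von Mangoldt mass up to `M` is `ψ(M) − θ(M)`. -/
theorem sum_nonprime_vonMangoldt_eq (M : ℕ) :
    ∑ m ∈ Finset.Icc 0 M, (if m.Prime then (0 : ℝ) else Λ m) = Chebyshev.psi M - Chebyshev.theta M := by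
  rw [Chebyshev.psi_eq_sum_Icc, Chebyshev.theta_eq_sum_Icc, Nat.floor_natCast, Finset.sum_filter,
    eq_sub_iff_add_eq, ← Finset.sum_add_distrib]
  refine Finset.sum_congr rfl fun m _ => ?_
  by_cases hm : m.Prime
  · simp [hm, ArithmeticFunction.vonMangoldt_apply_prime hm]
  · simp [hm]

/-- Chebyshev: the non-prime von Mangoldt mass up to `M ≥ 1` is `≤ 2√M·log M` (Mathlib). -/
theorem sum_nonprime_vonMangoldt_le {M : ℕ} (hM : 1 ≤ M) :
    ∑ m ∈ Finset.Icc 0 M, (if m.Prime then (0 : ℝ) else Λ m) ≤ 2 * Real.sqrt M * Real.log M := by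
  rw [sum_nonprime_vonMangoldt_eq]
  exact (le_abs_self _).trans (Chebyshev.abs_psi_sub_theta_le_sqrt_mul_log (by exact_mod_cast hM))

/-- Pointwise budget: with finitely many twins, `Σ_{n≤N} Λ(n)Λ(n+2) ≤ log²(N+2)·(#twins + 4√(N+2))`. -/
theorem twinMass_le_of_finite (hfin : twinSet.Finite) (N : ℕ) :
    X 2 N ≤ Real.log ((N : ℝ) + 2) ^ 2 * (hfin.toFinset.card + 4 * Real.sqrt ((N : ℝ) + 2)) := by
  classical
  set g : ℕ → ℝ := fun m => if m.Prime then (0 : ℝ) else Λ m with hg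
  have hL0 : 0 ≤ Real.log ((N : ℝ) + 2) :=
    Real.log_nonneg (by have := (Nat.cast_nonneg N : (0 : ℝ) ≤ N); linarith)
  have hg0 : ∀ m : ℕ, 0 ≤ g m := fun m => by
    by_cases hm : m.Prime
    · simp [hg, hm]
    · simp only [hg, hm, if_false]; exact ArithmeticFunction.vonMangoldt_nonneg
  have hgeq : ∀ m : ℕ, ¬ m.Prime → g m = Λ m := fun m hm => by simp [hg, hm]
  have hΛle : ∀ m : ℕ, m ≤ N + 2 → Λ m ≤ Real.log ((N : ℝ) + 2) := by
    intro m hm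
    rcases Nat.eq_zero_or_pos m with rfl | hm0
    · simpa using hL0
    · calc Λ m ≤ Real.log m := ArithmeticFunction.vonMangoldt_le_log
        _ ≤ Real.log ((N : ℝ) + 2) :=
          Real.log_le_log (by exact_mod_cast hm0) (by exact_mod_cast hm)
  have hpt : ∀ n ∈ Finset.Icc 1 N, Λ n * Λ (n + 2) ≤
      (if n ∈ twinSet then Real.log ((N : ℝ) + 2) ^ 2 else 0) +
        (Real.log ((N : ℝ) + 2) * g n + Real.log ((N : ℝ) + 2) * g (n + 2)) := by
    intro n hn
    rw [Finset.mem_Icc] at hn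
    have h1 : Λ n ≤ Real.log ((N : ℝ) + 2) := hΛle n (by omega)
    have h2 : Λ (n + 2) ≤ Real.log ((N : ℝ) + 2) := hΛle (n + 2) (by omega)
    have h0n : 0 ≤ Λ n := ArithmeticFunction.vonMangoldt_nonneg
    have h0n2 : 0 ≤ Λ (n + 2) := ArithmeticFunction.vonMangoldt_nonneg
    have hA := mul_nonneg hL0 (hg0 n)
    have hB := mul_nonneg hL0 (hg0 (n + 2))
    by_cases ht : n ∈ twinSet
    · rw [if_pos ht]
      have : Λ n * Λ (n + 2) ≤ Real.log ((N : ℝ) + 2) ^ 2 := by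
        rw [sq]; exact mul_le_mul h1 h2 h0n2 hL0
      linarith
    · rw [if_neg ht]
      by_cases hp : n.Prime
      · have hq : ¬ (n + 2).Prime := fun hq => ht ⟨hp, hq⟩
        have : Λ n * Λ (n + 2) ≤ Real.log ((N : ℝ) + 2) * g (n + 2) := by
          rw [hgeq _ hq]; exact mul_le_mul_of_nonneg_right h1 h0n2
        linarith
      · have : Λ n * Λ (n + 2) ≤ Real.log ((N : ℝ) + 2) * g n := by
          rw [hgeq _ hp, mul_comm (Real.log _)]; exact mul_le_mul_of_nonneg_left h2 h0n
        linarith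
  have hsum := Finset.sum_le_sum hpt
  rw [Finset.sum_add_distrib, Finset.sum_add_distrib] at hsum
  -- the twin part
  have hTw : ∑ n ∈ Finset.Icc 1 N, (if n ∈ twinSet then Real.log ((N : ℝ) + 2) ^ 2 else 0) ≤
      hfin.toFinset.card * Real.log ((N : ℝ) + 2) ^ 2 := by
    rw [← Finset.sum_filter]
    have hsub : (Finset.Icc 1 N).filter (fun n => n ∈ twinSet) ⊆ hfin.toFinset := by
      intro n hn
      rw [Finset.mem_filter] at hn
      exact hfin.mem_toFinset.mpr hn.2
    calc ∑ n ∈ (Finset.Icc 1 N).filter (fun n => n ∈ twinSet), Real.log ((N : ℝ) + 2) ^ 2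
        ≤ ∑ n ∈ hfin.toFinset, Real.log ((N : ℝ) + 2) ^ 2 :=
          Finset.sum_le_sum_of_subset_of_nonneg hsub fun _ _ _ => by positivity
      _ = hfin.toFinset.card * Real.log ((N : ℝ) + 2) ^ 2 := by
          rw [Finset.sum_const, nsmul_eq_mul]
  -- the non-prime parts (Chebyshev)
  have hCheb : ∑ m ∈ Finset.Icc 0 (N + 2), g m ≤ 2 * Real.sqrt ((N : ℝ) + 2) * Real.log ((N : ℝ) + 2) := by
    have := sum_nonprime_vonMangoldt_le (M := N + 2) (by omega)
    push_cast at this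
    exact this
  have hP1 : ∑ n ∈ Finset.Icc 1 N, Real.log ((N : ℝ) + 2) * g n ≤
      Real.log ((N : ℝ) + 2) * (2 * Real.sqrt ((N : ℝ) + 2) * Real.log ((N : ℝ) + 2)) := by
    rw [← Finset.mul_sum]
    refine mul_le_mul_of_nonneg_left (le_trans ?_ hCheb) hL0
    exact Finset.sum_le_sum_of_subset_of_nonneg
      (fun n hn => by rw [Finset.mem_Icc] at hn ⊢; omega) fun m _ _ => hg0 m
  have hre : ∑ n ∈ Finset.Icc 1 N, g (n + 2) =
      ∑ m ∈ (Finset.Icc 1 N).image (fun n => n + 2), g m := by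
    rw [Finset.sum_image]
    intro a _ b _ h
    simpa using h
  have hsub2 : (Finset.Icc 1 N).image (fun n => n + 2) ⊆ Finset.Icc 0 (N + 2) := by
    intro m hm
    rw [Finset.mem_image] at hm
    obtain ⟨a, ha, rfl⟩ := hm
    rw [Finset.mem_Icc] at ha ⊢
    omega
  have hP2 : ∑ n ∈ Finset.Icc 1 N, Real.log ((N : ℝ) + 2) * g (n + 2) ≤
      Real.log ((N : ℝ) + 2) * (2 * Real.sqrt ((N : ℝ) + 2) * Real.log ((N : ℝ) + 2)) := by
    rw [← Finset.mul_sum, hre]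
    refine mul_le_mul_of_nonneg_left (le_trans ?_ hCheb) hL0
    exact Finset.sum_le_sum_of_subset_of_nonneg hsub2 fun m _ _ => hg0 m
  have hX : X 2 N = ∑ n ∈ Finset.Icc 1 N, Λ n * Λ (n + 2) := rfl
  rw [hX]
  have hs0 : 0 ≤ Real.sqrt ((N : ℝ) + 2) := Real.sqrt_nonneg _
  nlinarith [hsum, hTw, hP1, hP2, hL0, hs0]

/-- Elementary growth lemma: `log²(N+2)·(C + 4√(N+2)) ≤ εN` eventually (from `log⁴ = o(id)`). -/
theorem eventually_logSq_sqrt_le {C ε : ℝ} (hC : 0 ≤ C) (hε : 0 < ε) :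
    ∃ N₀ : ℕ, ∀ N : ℕ, N₀ ≤ N →
      Real.log ((N : ℝ) + 2) ^ 2 * (C + 4 * Real.sqrt ((N : ℝ) + 2)) ≤ ε * N := by
  set η : ℝ := ε / (2 * (C + 4)) with hη
  have hη0 : 0 < η := by positivity
  have hlo := (Real.isLittleO_pow_log_id_atTop (n := 4)).def (sq_pos_of_pos hη0)
  obtain ⟨x₀, hx₀⟩ := Filter.eventually_atTop.mp hlo
  refine ⟨max ⌈x₀⌉₊ 2, fun N hN => ?_⟩
  have hN2 : 2 ≤ N := le_of_max_le_right hN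
  have hNx : x₀ ≤ (N : ℝ) + 2 := by
    have h1 : x₀ ≤ ⌈x₀⌉₊ := Nat.le_ceil x₀
    have h2 : (⌈x₀⌉₊ : ℝ) ≤ N := by exact_mod_cast le_of_max_le_left hN
    linarith
  set x : ℝ := (N : ℝ) + 2 with hx
  have hx1 : 1 ≤ x := by
    have := (Nat.cast_nonneg N : (0 : ℝ) ≤ N); rw [hx]; linarith
  have hx0 : 0 ≤ x := by linarith
  have hL0 : 0 ≤ Real.log x := Real.log_nonneg hx1
  have h4 : Real.log x ^ 4 ≤ η ^ 2 * x := by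
    have := hx₀ x hNx
    rwa [id, Real.norm_eq_abs, Real.norm_eq_abs, abs_of_nonneg (by positivity), abs_of_nonneg hx0] at this
  have hs : Real.sqrt x ^ 2 = x := Real.sq_sqrt hx0
  have hs0 : 0 ≤ Real.sqrt x := Real.sqrt_nonneg x
  -- log² x ≤ η √x
  have h2 : Real.log x ^ 2 ≤ η * Real.sqrt x := by
    have hsq : (Real.log x ^ 2) ^ 2 ≤ (η * Real.sqrt x) ^ 2 := by
      rw [mul_pow, hs, ← pow_mul]; exact h4
    exact (pow_le_pow_iff_left₀ (by positivity) (by positivity) two_ne_zero).mp hsq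
  -- √x ≤ x
  have hsx : Real.sqrt x ≤ x := by
    have h1s : 1 ≤ Real.sqrt x := Real.one_le_sqrt.mpr hx1
    nlinarith
  have hfin : Real.log x ^ 2 * (C + 4 * Real.sqrt x) ≤ η * (C + 4) * x := by
    calc Real.log x ^ 2 * (C + 4 * Real.sqrt x) ≤ η * Real.sqrt x * (C + 4 * Real.sqrt x) :=
          mul_le_mul_of_nonneg_right h2 (by positivity)
      _ = η * (C * Real.sqrt x + 4 * Real.sqrt x ^ 2) := by ring
      _ ≤ η * (C * x + 4 * x) := by
          refine mul_le_mul_of_nonneg_left ?_ hη0.le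
          nlinarith [mul_le_mul_of_nonneg_left hsx hC]
      _ = η * (C + 4) * x := by ring
  have hηC : η * (C + 4) = ε / 2 := by
    rw [hη]; field_simp
  rw [hηC] at hfin
  have hN2' : (2 : ℝ) ≤ N := by exact_mod_cast hN2
  calc Real.log x ^ 2 * (C + 4 * Real.sqrt x) ≤ ε / 2 * x := hfin
    _ = ε / 2 * ((N : ℝ) + 2) := by rw [hx]
    _ ≤ ε * N := by nlinarith

/-- **Finitely many twin primes ⟹ twin poverty** (prime powers are negligible by Chebyshev's `ψ − θ ≪ √x log x`). -/
theorem twinPoor_of_twinSet_finite (hfin : twinSet.Finite) : TwinPoor := by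
  intro ε hε
  obtain ⟨N₀, hN₀⟩ := eventually_logSq_sqrt_le (C := (hfin.toFinset.card : ℝ)) (Nat.cast_nonneg _) hε
  refine ⟨N₀, fun N hN => ?_⟩
  rw [abs_of_nonneg (X_nonneg 2 N)]
  exact (twinMass_le_of_finite hfin N).trans (hN₀ N hN)

/-- **(ii)** `¬TwinPoor` — equivalently the Chebyshev-i.o. twin lower bound — gives INFINITELY MANY TWIN PRIMES
(`Literature.Barriers.Parity.twinSet`, BY NAME). -/
theorem twinSet_infinite_of_not_twinPoor (h : ¬ TwinPoor) : twinSet.Infinite :=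
  mt twinPoor_of_twinSet_finite h

/-- The Chebyshev-i.o. twin lower bound gives infinitely many twin primes. -/
theorem twinSet_infinite_of_chebyshevIO (h : ChebyshevIO (X 2)) : twinSet.Infinite :=
  twinSet_infinite_of_not_twinPoor (not_twinPoor_iff_chebyshevIO.mpr h)

/-- The eventual Chebyshev twin lower bound (Λ-form of stmt-Parity-18377) gives infinitely many twin primes. -/
theorem twinSet_infinite_of_chebyshevEv (h : ChebyshevEv (X 2)) : twinSet.Infinite :=
  twinSet_infinite_of_not_twinPoor (not_twinPoor_of_chebyshevEv h)

/-- The scale of worlds: `W₀ := twinSet.Finite` («finitely many twins») implies `W := TwinPoor`; so every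
`W`-vacuous piece is `W₀`-vacuous and every `W₀`-refuting piece's content is at least `twinSet.Infinite`. -/
theorem twinPoor_scale : (twinSet.Finite → TwinPoor) ∧ (¬ TwinPoor → twinSet.Infinite) :=
  ⟨twinPoor_of_twinSet_finite, twinSet_infinite_of_not_twinPoor⟩

/-! ### §5.4 (i)+(iv) at the root: every residual family beneath `Parity` refutes `TwinPoor` -/

/-- **Root conservation (n-ary).** For every split `Parity ⟸ ⋀ᵢ Pᵢ` (through ANY family of routes) and every
sub-family `V` of `TwinPoor`-vacuous pieces, the remaining pieces jointly imply `¬TwinPoor`. -/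
theorem root_conservation {ι : Sort*} (P V : ι → Prop) (hs : (∀ i, P i) → _root_.Parity)
    (hV : ∀ i, V i → TwinPoor → P i) : (∀ i, ¬ V i → P i) → ¬ TwinPoor :=
  complement_refutes_family P V hs parity_refutes_twinPoor hV

/-- The same beneath the conjunct `GeneralizedHardyLittlewood`. -/
theorem ghl_conservation {ι : Sort*} (P V : ι → Prop) (hs : (∀ i, P i) → _root_.GeneralizedHardyLittlewood)
    (hV : ∀ i, V i → TwinPoor → P i) : (∀ i, ¬ V i → P i) → ¬ TwinPoor :=
  complement_refutes_family P V hs ghl_refutes_twinPoor hV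

/-- The same beneath the record leaf `FixedLower` (stmt-Parity-26863): every notch `FixedLower ⟸ A ∧ B` with a
`TwinPoor`-vacuous `A` has `B → ¬TwinPoor`. -/
theorem fixedLower_conservation {A B : Prop} (hs : A → B → Theses.SiegelSpectrumSplit.FixedLower)
    (hA : TwinPoor → A) : B → ¬ TwinPoor :=
  complement_refutes hA hs fixedLower_refutes_twinPoor

/-- No split of the root can consist of `TwinPoor`-vacuous pieces only (else `¬TwinPoor`, i.e. the twin prime
conjecture in Chebyshev-i.o. form, would already be proved by the assembly). -/
theorem root_not_all_vacuous {ι : Sort*} (P : ι → Prop) (hs : (∀ i, P i) → _root_.Parity) :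
    (∀ i, TwinPoor → P i) → ¬ TwinPoor :=
  all_vacuous_refutes P hs parity_refutes_twinPoor

/-- (iv, lens-6 leaf ClusterGapCarving at the root) the residual pair `{FarSomePair, PairSync}` is the route's
W-refuting locus and `TwinResidualRel` is W-vacuous — hypothesis-free instances of `root_conservation`. -/
theorem clusterGap_locus :
    (TwinPoor → Theses.ClusterGapCarving.TwinResidualRel) ∧
      (Theses.ClusterGapCarving.FarSomePair → Theses.ClusterGapCarving.PairSync → ¬ TwinPoor) ∧
        (AllPairsPoor → Theses.ClusterGapCarving.PairSync ∧ TwinPoor) :=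
  ⟨twinResidualRel_of_twinPoor, not_twinPoor_of_far_sync, pairSync_consistent_with_allPoor⟩

end Root

end Summit.Parity.GeneralizedHardyLittlewood.ExistenceConservation
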